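import Summits.BirchSwinnertonDyer.BirchSwinnertonDyer.Theorems.ManinLocalTwoThreeKummerCubeAnalyticTaylor
import Literature.NumberTheory.EllipticCurves.FormalGroupDictionaryProofs
import Literature.NumberTheory.EllipticCurves.FormalGroupDenominators
import Literature.NumberTheory.EllipticCurves.UniformizationUniqueProofs
import HarnessLib

/-!
# S1 prelims (2/2): the local parameter `t = −x/y`, `w = −1/y`, `g = t²x` along a uniformisation and their Taylor series
# (route `ManinLocalTwoThree`, crux C3 `ManinPrimeToThreeAtNine` stmt-BirchSwinnertonDyer-22968; cell bsd-f2-manin, an g37, MEMO-an §80.9)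

For a Weierstrass curve `V/ℂ` and a period pair `L` with `g₂(L) = c₄(V)/12`, `g₃(L) = c₆(V)/216`:

* (defined in prelims (1/2) `…KummerCubeAnalyticTaylor.lean`) `locT`, `locW`, `locG`, `locKummer` — `t = −x/y`, `w = −1/y`,
  `g = t²·x` (extended by `0, 0, 1` on `Λ`) and the tangent-line Kummer germ `−g − Y₀t³ − α(g·t − X₀t³) = t³(y − Y₀ − α(x − X₀))`
  in the uniformising variable; this file proves their analyticity at `0` and computes their Taylor series:
* `taylorAt0_locT : 𝓣[t] = exp_V` — the tree's **Bost identification of the formal and analytic leaves**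
  (`WeierstrassCurve.taylor_localParam_eq_formalExp`);
* `taylorAt0_locW : 𝓣[w] = formalW(exp_V)` — the Weierstrass equation divided by `y³` is the fixed-point equation of
  AEC IV.1.1 (`equation_weierstrassP_sub`), and the fixed point is unique (`fixedPoint_unique`, `formalW_subst_eq_step`);
* `taylorAt0_locG : 𝓣[g] = formalXMulSq(exp_V)` — from `g·w = t³`, `formalXMulSq·formalW = X³` and cancellation of
  `formalW(exp_V) ≠ 0` in the domain `ℂ⟦X⟧` (`g` is analytic at `0`: `g = 4(1 + z²P)³/Q²` with the analytic parts of
  `localParam_eventuallyEq`);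
* `taylorAt0_locKummer : 𝓣[locKummer] = formalKummer(exp_V)` with
  `formalKummer V α X₀ Y₀ = −formalXMulSq − Y₀X³ − α(formalXMulSq·X − X₀X³)`.

HONEST FRAMING: a routine analytic leaf of a CONDITIONAL reduction; E-an-57, C3 `ManinPrimeToThreeAtNine`, Manin's `c = 1`
remain OPEN; nothing about BSD is proved.  PARTITION unchanged · beyond-print theorem: no · BSD is not proved by this.
[cite: SilvermanAEC2009, IV.1.1 (the fixed-point recursion for w(z)), VI.3.6 (uniformisation; shape)] [cite: Bost2001AlgebraicLeaves, §3.4.1 and Cor. 2.5 (shape)]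
-/

set_option autoImplicit false
-- lint-debt: the directory name repeats the summit name (sibling precedent `ManinLocalTwoThreeKummerCubeSigmaLeaves.lean`)
set_option linter.dupNamespace false

noncomputable section

open Complex Filter Topology PowerSeries CongruenceSubgroup
open scoped PeriodPair UpperHalfPlane MatrixGroups ModularForm Nat Classical
open WeierstrassCurve Literature.NumberTheory.EllipticCurves Literature.NumberTheory.EllipticCurves.ModularForms
open Literature.NumberTheory.Transcendental.AndreCriterion UpperHalfPlane
open Summit.BirchSwinnertonDyer.Rank1Residual.ManinAdditive.CuspidalKummer
open Summit.BirchSwinnertonDyer.Rank1Residual.ManinAdditive.CuspidalKummerThree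

namespace Summit.BirchSwinnertonDyer.BirchSwinnertonDyer.Theorems.ManinLocalTwoThree.KummerCubeAnalytic

open Summit.BirchSwinnertonDyer.Rank1Residual.ManinAdditive.KummerCubeMonodromy

/-- `locT` is analytic at `0`. [folklore] -/
theorem analyticAt_locT (L : PeriodPair) (V : WeierstrassCurve ℂ) : AnalyticAt ℂ (locT L V) 0 :=
  (WeierstrassCurve.analyticAt_localParam L V).1

/-- `locW` is analytic at `0`. [folklore] -/
theorem analyticAt_locW (L : PeriodPair) (V : WeierstrassCurve ℂ) : AnalyticAt ℂ (locW L V) 0 :=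
  (WeierstrassCurve.analyticAt_localParam L V).2

/-- `locT 0 = 0`. [folklore] -/
theorem locT_zero (L : PeriodPair) (V : WeierstrassCurve ℂ) : locT L V 0 = 0 := by
  rw [locT]; exact if_pos (show (0 : ℂ) ∈ L.lattice from zero_mem _)

/-- `locW 0 = 0`. [folklore] -/
theorem locW_zero (L : PeriodPair) (V : WeierstrassCurve ℂ) : locW L V 0 = 0 := by
  rw [locW]; exact if_pos (show (0 : ℂ) ∈ L.lattice from zero_mem _)

/-- `𝓣[t] = exp_V` (the tree's `taylor_localParam_eq_formalExp`). [cite: Bost2001AlgebraicLeaves, §3.4.1 and Cor. 2.5 (proof)] -/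
theorem taylorAt0_locT (L : PeriodPair) (V : WeierstrassCurve ℂ) (h₂ : L.g₂ = V.c₄ / 12)
    (h₃ : L.g₃ = V.c₆ / 216) : taylorAt0 (locT L V) = V.formalExp :=
  WeierstrassCurve.taylor_localParam_eq_formalExp L V h₂ h₃

/-- `𝓣[w] = w(exp_V)` for the tree's `formalW` (the Weierstrass equation divided by `y³` is the fixed-point
equation of AEC IV.1.1, and the fixed point is unique). [folklore] -/
theorem taylorAt0_locW (L : PeriodPair) (V : WeierstrassCurve ℂ) (h₂ : L.g₂ = V.c₄ / 12)
    (h₃ : L.g₃ = V.c₆ / 216) : taylorAt0 (locW L V) = V.formalW.subst V.formalExp := by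
  have hta := analyticAt_locT L V
  have hwa := analyticAt_locW L V
  have hy := WeierstrassCurve.eventually_y_ne_zero L V
  have hΛ := L.eventually_nhdsNE_notMem_lattice
  set x : ℂ → ℂ := fun z => ℘[L] z - V.b₂ / 12 with hx
  set y : ℂ → ℂ := fun z => (℘'[L] z - V.a₁ * (℘[L] z - V.b₂ / 12) - V.a₃) / 2 with hydef
  set t := locT L V with ht
  set w := locW L V with hw
  have ht0 : t 0 = 0 := locT_zero L V
  have hw0 : w 0 = 0 := locW_zero L V
  have htz : ∀ z, z ∉ L.lattice → t z = -x z / y z := fun z hz => by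
    rw [ht, locT]; exact if_neg hz
  have hwz : ∀ z, z ∉ L.lattice → w z = -1 / y z := fun z hz => by
    rw [hw, locW]; exact if_neg hz
  -- (E1): the Weierstrass equation divided by `y³`
  have hE1 : w =ᶠ[𝓝 0] fun z => t z ^ 3 + V.a₁ * (t * w) z + V.a₂ * (t ^ 2 * w) z +
      V.a₃ * (w ^ 2) z + V.a₄ * (t * w ^ 2) z + V.a₆ * (w ^ 3) z := by
    refine Literature.NumberTheory.EllipticCurves.eventually_nhds_of_nhdsNE ?_ (by simp [ht0, hw0])
    filter_upwards [hΛ, hy] with z hzΛ hyz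
    simp only [Pi.mul_apply, Pi.pow_apply]
    rw [htz z hzΛ, hwz z hzΛ]
    have heq := WeierstrassCurve.equation_weierstrassP_sub L V h₂ h₃ hzΛ
    change y z ^ 2 + V.a₁ * x z * y z + V.a₃ * y z = x z ^ 3 + V.a₂ * x z ^ 2 + V.a₄ * x z + V.a₆
      at heq
    have key : -1 / y z - ((-x z / y z) ^ 3 + V.a₁ * (-x z / y z * (-1 / y z)) +
        V.a₂ * ((-x z / y z) ^ 2 * (-1 / y z)) + V.a₃ * (-1 / y z) ^ 2 +
        V.a₄ * (-x z / y z * (-1 / y z) ^ 2) + V.a₆ * (-1 / y z) ^ 3) =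
        (-1 / y z ^ 3) * ((y z ^ 2 + V.a₁ * x z * y z + V.a₃ * y z) -
          (x z ^ 3 + V.a₂ * x z ^ 2 + V.a₄ * x z + V.a₆)) := by
      field_simp
      ring
    rw [heq, sub_self, mul_zero, sub_eq_zero] at key
    exact key
  have hfun1 : (fun z => t z ^ 3 + V.a₁ * (t * w) z + V.a₂ * (t ^ 2 * w) z +
      V.a₃ * (w ^ 2) z + V.a₄ * (t * w ^ 2) z + V.a₆ * (w ^ 3) z) =
      t ^ 3 + (fun z => V.a₁ * (t * w) z) + (fun z => V.a₂ * (t ^ 2 * w) z) +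
        (fun z => V.a₃ * (w ^ 2) z) + (fun z => V.a₄ * (t * w ^ 2) z) +
        (fun z => V.a₆ * (w ^ 3) z) := by
    funext z
    simp only [Pi.add_apply, Pi.pow_apply]
  have h1 : AnalyticAt ℂ (t ^ 3) 0 := hta.pow 3
  have h2 : AnalyticAt ℂ (fun z => V.a₁ * (t * w) z) 0 := analyticAt_const.fun_mul (hta.mul hwa)
  have h3 : AnalyticAt ℂ (fun z => V.a₂ * (t ^ 2 * w) z) 0 :=
    analyticAt_const.fun_mul ((hta.pow 2).mul hwa)
  have h4 : AnalyticAt ℂ (fun z => V.a₃ * (w ^ 2) z) 0 := analyticAt_const.fun_mul (hwa.pow 2)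
  have h5 : AnalyticAt ℂ (fun z => V.a₄ * (t * w ^ 2) z) 0 :=
    analyticAt_const.fun_mul (hta.mul (hwa.pow 2))
  have h6 : AnalyticAt ℂ (fun z => V.a₆ * (w ^ 3) z) 0 := analyticAt_const.fun_mul (hwa.pow 3)
  have hF1 : taylorAt0 w = taylorAt0 t ^ 3 + C V.a₁ * taylorAt0 t * taylorAt0 w +
      C V.a₂ * taylorAt0 t ^ 2 * taylorAt0 w + C V.a₃ * taylorAt0 w ^ 2 +
      C V.a₄ * taylorAt0 t * taylorAt0 w ^ 2 + C V.a₆ * taylorAt0 w ^ 3 := by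
    have h : taylorAt0 w = taylorAt0 _ := taylor_congr hE1
    simp only [taylorAt0] at h ⊢
    rw [hfun1,
      taylor_add ((((h1.add h2).add h3).add h4).add h5) h6,
      taylor_add (((h1.add h2).add h3).add h4) h5, taylor_add ((h1.add h2).add h3) h4,
      taylor_add (h1.add h2) h3, taylor_add h1 h2, taylor_pow hta 3,
      taylor_const_mul, taylor_mul hta hwa, taylor_const_mul, taylor_mul (hta.pow 2) hwa,
      taylor_pow hta 2, taylor_const_mul, taylor_pow hwa 2, taylor_const_mul,
      taylor_mul hta (hwa.pow 2), taylor_pow hwa 2, taylor_const_mul, taylor_pow hwa 3] at h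
    refine h.trans ?_
    ring
  have hT : taylorAt0 t = V.formalExp := taylorAt0_locT L V h₂ h₃
  rw [hT] at hF1
  have hE0 : constantCoeff V.formalExp = 0 := V.constantCoeff_formalExp
  have hY0 : constantCoeff (taylorAt0 w) = 0 := by rw [constantCoeff_taylorAt0, hw0]
  exact V.fixedPoint_unique hE0 hY0
    (PowerSeries.constantCoeff_subst_eq_zero hE0 _ V.constantCoeff_formalW) hF1
    (V.formalW_subst_eq_step hE0)

/-- `g·w = t³` identically. [folklore] -/
theorem locG_mul_locW (L : PeriodPair) (V : WeierstrassCurve ℂ) :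
    locG L V * locW L V = locT L V ^ 3 := by
  funext z
  simp only [Pi.mul_apply, Pi.pow_apply, locG, locW, locT]
  by_cases hz : z ∈ L.lattice
  · simp [hz]
  · simp only [hz, if_false]
    by_cases hy : (℘'[L] z - V.a₁ * (℘[L] z - V.b₂ / 12) - V.a₃) / 2 = 0
    · rw [hy]; simp
    · field_simp

/-- `g` is analytic at `0` with `g(0) = 1`: near `0`, `g = 4(1 + z²P)³/Q²` with the analytic parts
`P = ℘₀ − b₂/12`, `Q = 2 + a₁z + a₁z³P + a₃z³ − z³℘₀'` of the tree's `localParam_eventuallyEq`. [folklore] -/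
theorem analyticAt_locG (L : PeriodPair) (V : WeierstrassCurve ℂ) : AnalyticAt ℂ (locG L V) 0 := by
  obtain ⟨ht, -⟩ := WeierstrassCurve.localParam_eventuallyEq L V
  have hΛ := L.eventually_nhdsNE_notMem_lattice
  set P : ℂ → ℂ := fun z => ℘[L - (0 : ℂ)] z - V.b₂ / 12 with hP
  set Q : ℂ → ℂ := fun z => 2 + V.a₁ * z + V.a₁ * z ^ 3 * (℘[L - (0 : ℂ)] z - V.b₂ / 12) +
    V.a₃ * z ^ 3 - z ^ 3 * ℘'[L - (0 : ℂ)] z with hQ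
  have hEa : AnalyticAt ℂ ℘[L - (0 : ℂ)] 0 := L.analyticAt_weierstrassPExcept 0
  have hE'a : AnalyticAt ℂ ℘'[L - (0 : ℂ)] 0 := L.analyticAt_derivWeierstrassPExcept 0
  have hQa : AnalyticAt ℂ Q 0 := by rw [hQ]; fun_prop
  have hQ0 : Q 0 ≠ 0 := by simp [hQ]
  have hRa : AnalyticAt ℂ (fun z => 4 * (1 + z ^ 2 * P z) ^ 3 / Q z ^ 2) 0 := by
    have hPa : AnalyticAt ℂ P 0 := by rw [hP]; fun_prop
    exact ((analyticAt_const.mul ((analyticAt_const.add ((analyticAt_id.pow 2).mul hPa)).pow 3)).div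
      (hQa.pow 2) (pow_ne_zero 2 hQ0))
  refine hRa.congr ?_
  -- `g = 4(1 + z²P)³/Q²` near `0`
  have hQne : ∀ᶠ z in 𝓝 (0 : ℂ), Q z ≠ 0 := hQa.continuousAt.eventually_ne hQ0
  refine Literature.NumberTheory.EllipticCurves.eventually_nhds_of_nhdsNE ?_ ?_
  · filter_upwards [hΛ, mem_nhdsWithin_of_mem_nhds ht, mem_nhdsWithin_of_mem_nhds hQne,
      self_mem_nhdsWithin] with z hzΛ htz hQz hz0
    have hz0' : (z : ℂ) ≠ 0 := hz0
    rw [locG, if_neg hzΛ, locT, htz]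
    change 4 * (1 + z ^ 2 * P z) ^ 3 / Q z ^ 2 = ((2 * z + 2 * z ^ 3 * P z) / Q z) ^ 2 * (℘[L] z - V.b₂ / 12)
    have hPz : ℘[L] z - V.b₂ / 12 = 1 / z ^ 2 + P z := by
      rw [hP, L.weierstrassP_eq_weierstrassPExcept_add z]
      ring
    rw [hPz]
    field_simp
    ring
  · rw [locG, if_pos (show (0 : ℂ) ∈ L.lattice from zero_mem _)]
    simp [hQ]
    norm_num

/-! #### `𝓣[g] = (X²x)(exp_V)` and the Taylor series of the Kummer germ -/

/-- `𝓣[g] = formalXMulSq(exp_V)`: from `g·w = t³`, `𝓣[w] = formalW(exp_V)`, `𝓣[t] = exp_V` and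
`formalXMulSq · formalW = X³`, cancelling the non-zero factor `formalW(exp_V)`. [folklore] -/
theorem taylorAt0_locG (L : PeriodPair) (V : WeierstrassCurve ℂ) (h₂ : L.g₂ = V.c₄ / 12)
    (h₃ : L.g₃ = V.c₆ / 216) : taylorAt0 (locG L V) = V.formalXMulSq.subst V.formalExp := by
  have hga := analyticAt_locG L V
  have hwa := analyticAt_locW L V
  have hta := analyticAt_locT L V
  have hE0 : constantCoeff V.formalExp = 0 := V.constantCoeff_formalExp
  have hs : HasSubst V.formalExp := HasSubst.of_constantCoeff_zero' hE0
  have h1 : taylorAt0 (locG L V) * taylorAt0 (locW L V) = taylorAt0 (locT L V) ^ 3 := by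
    have h := congrArg taylorAt0 (locG_mul_locW L V)
    simp only [taylorAt0] at h ⊢
    rw [taylor_mul hga hwa, taylor_pow hta 3] at h
    exact h
  rw [taylorAt0_locW L V h₂ h₃, taylorAt0_locT L V h₂ h₃] at h1
  have h2 : V.formalXMulSq.subst V.formalExp * V.formalW.subst V.formalExp = V.formalExp ^ 3 := by
    rw [← coe_substAlgHom hs, ← map_mul, V.formalW_eq_X_pow_mul_formalWDivCube,
      show V.formalXMulSq * (X ^ 3 * V.formalWDivCube) = X ^ 3 * (V.formalWDivCube * V.formalXMulSq) by
        ring,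
      V.formalWDivCube_mul_formalXMulSq, mul_one, map_pow, substAlgHom_X hs]
  have hE1 : coeff 1 V.formalExp = 1 := by
    rw [← taylorAt0_locT L V h₂ h₃]
    simp only [taylorAt0]
    rw [coeff_one_taylor]
    exact WeierstrassCurve.deriv_localParam_zero L V
  have hEne : V.formalExp ≠ 0 := by
    intro h
    rw [h, map_zero] at hE1
    exact zero_ne_one hE1
  have hne : V.formalW.subst V.formalExp ≠ 0 := by
    intro h0
    rw [h0, mul_zero] at h2
    exact pow_ne_zero 3 hEne h2.symm
  exact mul_right_cancel₀ hne (h1.trans h2.symm)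

/-- `locKummer` is analytic at `0`. [folklore] -/
theorem analyticAt_locKummer (L : PeriodPair) (V : WeierstrassCurve ℂ) (α X₀ Y₀ : ℂ) :
    AnalyticAt ℂ (locKummer L V α X₀ Y₀) 0 := by
  have hg := analyticAt_locG L V
  have ht := analyticAt_locT L V
  change AnalyticAt ℂ (fun z => -locG L V z - Y₀ * locT L V z ^ 3 -
    α * (locG L V z * locT L V z - X₀ * locT L V z ^ 3)) 0
  fun_prop

/-- `𝓣[locKummer] = formalKummer(exp_V)`. [folklore] -/
theorem taylorAt0_locKummer (L : PeriodPair) (V : WeierstrassCurve ℂ) (h₂ : L.g₂ = V.c₄ / 12)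
    (h₃ : L.g₃ = V.c₆ / 216) (α X₀ Y₀ : ℂ) :
    taylorAt0 (locKummer L V α X₀ Y₀) = (formalKummer V α X₀ Y₀).subst V.formalExp := by
  have hga := analyticAt_locG L V
  have hta := analyticAt_locT L V
  have hE0 : constantCoeff V.formalExp = 0 := V.constantCoeff_formalExp
  have hs : HasSubst V.formalExp := HasSubst.of_constantCoeff_zero' hE0
  set g := locG L V with hg
  set t := locT L V with ht
  have hfun : locKummer L V α X₀ Y₀ = (fun z => (-1 : ℂ) * g z) - (fun z => Y₀ * (t ^ 3) z) -
      (fun z => α * ((g * t) - (fun w => X₀ * (t ^ 3) w)) z) := by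
    funext z
    simp only [locKummer, hg, ht, Pi.sub_apply, Pi.mul_apply, Pi.pow_apply]
    ring
  have a1 : AnalyticAt ℂ (fun z => (-1 : ℂ) * g z) 0 := analyticAt_const.fun_mul hga
  have a2 : AnalyticAt ℂ (fun z => Y₀ * (t ^ 3) z) 0 := analyticAt_const.fun_mul (hta.pow 3)
  have a4 : AnalyticAt ℂ (fun w => X₀ * (t ^ 3) w) 0 := analyticAt_const.fun_mul (hta.pow 3)
  have a3i : AnalyticAt ℂ ((g * t) - (fun w => X₀ * (t ^ 3) w)) 0 := (hga.mul hta).sub a4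
  have a3 : AnalyticAt ℂ (fun z => α * ((g * t) - (fun w => X₀ * (t ^ 3) w)) z) 0 :=
    analyticAt_const.fun_mul a3i
  have hTg : taylorAt0 g = V.formalXMulSq.subst V.formalExp := taylorAt0_locG L V h₂ h₃
  have hTt : taylorAt0 t = V.formalExp := taylorAt0_locT L V h₂ h₃
  rw [hfun]
  simp only [taylorAt0] at hTg hTt ⊢
  rw [Literature.NumberTheory.EllipticCurves.taylor_sub (a1.sub a2) a3,
    Literature.NumberTheory.EllipticCurves.taylor_sub a1 a2, taylor_const_mul, taylor_const_mul,
    taylor_pow hta 3, taylor_const_mul,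
    Literature.NumberTheory.EllipticCurves.taylor_sub (hga.mul hta) a4, taylor_mul hga hta,
    taylor_const_mul, taylor_pow hta 3, hTg, hTt, formalKummer, ← coe_substAlgHom hs]
  simp only [map_sub, map_neg, map_mul, map_pow, substAlgHom_X hs,
    Literature.NumberTheory.EllipticCurves.substAlgHom_C hs, coe_substAlgHom]
  simp only [map_one]
  ring

end Summit.BirchSwinnertonDyer.BirchSwinnertonDyer.Theorems.ManinLocalTwoThree.KummerCubeAnalytic

end
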